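import Literature.NumberTheory.EllipticCurves.CyclotomicLayerRhoTatePairingPk
import Literature.Algebra.InverseSystem.PadicIntLift
import HarnessLib

/-!
# The `ℤ_p`-valued layer Tate pairings as the GLUE of their residues modulo `p^k`
# (`tatePairingAdic` for `T_pW`, `rhoLayerPairingAdic` for the lattice `T_ρ` of a framed representation)

Topic `NumberTheory/EllipticCurves`, namespace `Literature.NumberTheory.EllipticCurves.CyclotomicLayer`. Definition typer `bsd-wall-defn-rho`
(cell `bsd-wall`): PIN-SPEC-S2-g16 (R1)/(D4 iii) of crux RSL_g (stmt-BirchSwinnertonDyer-22608) and the (D-layer) item of TP2's K3 line, in the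
tree's currency. DEFINITIONS WITH BODIES + proved lemmas; no named fact, no instance, no notation; nothing about BSD is claimed.

The tree has the finite-coefficient layer pairings
* `CyclotomicLayer.tatePairingPk W κ v n k : H¹(Γ_n, T_pW) →+ (E(ℚ_{n,v}) →+ ℤ/p^k)` (Weil pairings; `CyclotomicLayerTatePairing`),
* `CyclotomicLayer.rhoLayerPairingPk S ρ W ePk … Θ κ v hΘ n k : H¹(Γ_n, T_ρ) →+ (E(ℚ_{n,v})^r →+ ℤ/p^k)` (a self-duality datum `ePk` of `A_ρ[p^k]`
  and a transport `Θ : A_ρ ≃+ E[p^∞]^r`; `CyclotomicLayerRhoTatePairingPk`),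
and their PINNING lemmas (`eq_of_forall_toZModPow_eq_tatePairingPk` / `…_rhoLayerPairingPk`: a `ℤ_p`-valued family with these residues is unique).
THIS FILE names the pinned object: GIVEN that the residues are compatible along `ℤ/p^{k+1} → ℤ/p^k` (hypothesis `hcompat` — for the Weil
tower it is the projection formula of the cup product under `μ_{p^{k+1}} → μ_{p^k}`, cf. `weilTowerPk_succ_of_coe_eq`; for `ρ` it holds when the
family `ePk` is a tower; a kernel statement of the routes, NOT proved here), the generic glue `Literature.Algebra.InverseSystem.padicIntLift₂`
(`Hom(A, ℤ_p) = lim_k Hom(A, ℤ/p^k)`, file `PadicIntLift`) produces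
* **`tatePairingAdic W κ v n hcompat : H¹(Γ_n, T_pW) →+ (E(ℚ_{n,v}) →+ ℤ_p)`** and its `ℤ_p`-linear upgrade `tatePairingAdicLinear` (given the
  semilinearity `hlin` of the residues in the class),
* **`rhoLayerPairingAdic S ρ W ePk … Θ κ v hΘ n hcompat : H¹(Γ_n, T_ρ) →+ (E(ℚ_{n,v})^r →+ ℤ_p)`** (values in `ℤ_p`, memo (R1): `λ_{ℤ_p} = [F:ℚ_p]·λ_𝒪`),
with the residue formulas `toZModPow k (… x Q) = …Pk n k x Q` and uniqueness (`eq_…_of_toZModPow`): THE `ℤ_p`-valued local Tate pairing of the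
`n`-th layer (Perrin-Riou §3.6.1: the `Λ`-adic pairing as the limit of the finite-level pairings; Kato §13.8: `T → T/p^k`).

References: [PerrinRiou1994Invent] §3.6.1; [Kato2004Asterisque] §13.8 (pp. 228–229), §14.9 (p. 239); [Kobayashi2003] (8.23) (p. 18);
[Milne2025] Ch. V §1.
-/

noncomputable section

open scoped Classical

namespace Literature.NumberTheory.EllipticCurves

open CategoryTheory Field NumberField IsDedekindDomain _root_.WeierstrassCurve
  Literature.NumberTheory.GaloisRepresentations
  Literature.NumberTheory.EllipticCurves.Kobayashi2003
  Literature.NumberTheory.EllipticCurves.Kato2004 Literature.NumberTheory.EllipticCurves.Kato2004.EulerSystemValues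
  Literature.NumberTheory.GaloisCohomology ZpExtension
  Literature.NumberTheory.EllipticCurves.GreenbergSelmer
  Literature.Algebra.InverseSystem

namespace CyclotomicLayer

/-! ## §1 `T_pW`: the glue of `tatePairingPk` -/

section Weil

variable {p : ℕ} [Fact p.Prime] (W : WeierstrassCurve ℚ) [W.IsElliptic] (κ : ZpExtension ℚ p) (v : HeightOneSpectrum (𝓞 ℚ))
  [ContinuousSMul ℤ_[p] (W.tateModule p)] (n : ℕ)
  (hcompat : ∀ (k : ℕ) (x : H1 (tateRep W p) (κ.layerSubgroup n))
    (Q : localLayerPointsOfEmb κ (closureEmb (K := ℚ) (v.adicCompletion ℚ)) W n),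
    (ZMod.cast (tatePairingPk W κ v n (k + 1) x Q) : ZMod (p ^ k)) = tatePairingPk W κ v n k x Q)

/-- **THE `ℤ_p`-valued local Tate pairing of the `n`-th layer for `T_pW`**, `H¹(Γ_n, T_pW) →+ (E(ℚ_{n,v}) →+ ℤ_p)`: the glue
(`padicIntLift₂`) of the finite-coefficient pairings `tatePairingPk W κ v n k` (values in `ℤ/p^k`), GIVEN their compatibility `hcompat`
along `ℤ/p^{k+1} → ℤ/p^k`. Its residues are the `tatePairingPk` (`toZModPow_tatePairingAdic`) and it is the only such homomorphism
(`eq_tatePairingAdic_of_toZModPow`). [cite: PerrinRiou1994Invent, §3.6.1] [cite: Kobayashi2003, (8.23) (p. 18)]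
[cite: Kato2004Asterisque, §13.8 (pp. 228–229)] -/
def tatePairingAdic :
    H1 (tateRep W p) (κ.layerSubgroup n) →+ (localLayerPointsOfEmb κ (closureEmb (K := ℚ) (v.adicCompletion ℚ)) W n →+ ℤ_[p]) :=
  padicIntLift₂ p (fun k ↦ tatePairingPk W κ v n k) hcompat

/-- **Residue formula**: `tatePairingAdic … x Q mod p^k = tatePairingPk W κ v n k x Q`. [cite: PerrinRiou1994Invent, §3.6.1] -/
@[simp]
theorem toZModPow_tatePairingAdic (k : ℕ) (x : H1 (tateRep W p) (κ.layerSubgroup n))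
    (Q : localLayerPointsOfEmb κ (closureEmb (K := ℚ) (v.adicCompletion ℚ)) W n) :
    PadicInt.toZModPow k (tatePairingAdic W κ v n hcompat x Q) = tatePairingPk W κ v n k x Q :=
  toZModPow_padicIntLift₂ p _ hcompat k x Q

/-- **Uniqueness**: a bi-additive `F : H¹(Γ_n, T_pW) →+ (E(ℚ_{n,v}) →+ ℤ_p)` whose residues are the `tatePairingPk` IS `tatePairingAdic`.
[cite: PerrinRiou1994Invent, §3.6.1] -/
theorem eq_tatePairingAdic_of_toZModPow
    {F : H1 (tateRep W p) (κ.layerSubgroup n) →+ (localLayerPointsOfEmb κ (closureEmb (K := ℚ) (v.adicCompletion ℚ)) W n →+ ℤ_[p])}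
    (hF : ∀ (k : ℕ) (x : H1 (tateRep W p) (κ.layerSubgroup n))
      (Q : localLayerPointsOfEmb κ (closureEmb (K := ℚ) (v.adicCompletion ℚ)) W n),
      PadicInt.toZModPow k (F x Q) = tatePairingPk W κ v n k x Q) :
    F = tatePairingAdic W κ v n hcompat :=
  eq_padicIntLift₂_of_toZModPow p _ hcompat hF

variable (hlin : ∀ (k : ℕ) (c : ℤ_[p]) (x : H1 (tateRep W p) (κ.layerSubgroup n))
    (Q : localLayerPointsOfEmb κ (closureEmb (K := ℚ) (v.adicCompletion ℚ)) W n),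
    tatePairingPk W κ v n k (c • x) Q = PadicInt.toZModPow k c * tatePairingPk W κ v n k x Q)

/-- **The `ℤ_p`-LINEAR layer pairing** `H¹(Γ_n, T_pW) →ₗ[ℤ_p] (E(ℚ_{n,v}) →+ ℤ_p)` (TP2's (D-layer) shape): `tatePairingAdic`, linear in the
class GIVEN the semilinearity `hlin` of the residues (`⟨c•x, Q⟩_k = (c mod p^k)·⟨x, Q⟩_k`). [cite: PerrinRiou1994Invent, §3.6.1]
[cite: Kato2004Asterisque, §13.8 (pp. 228–229)] -/
def tatePairingAdicLinear :
    H1 (tateRep W p) (κ.layerSubgroup n) →ₗ[ℤ_[p]] (localLayerPointsOfEmb κ (closureEmb (K := ℚ) (v.adicCompletion ℚ)) W n →+ ℤ_[p]) :=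
  padicIntLinearLift₂ p (fun k ↦ tatePairingPk W κ v n k) hcompat hlin

/-- `tatePairingAdicLinear` is `tatePairingAdic` as a function (`rfl`). [cite: PerrinRiou1994Invent, §3.6.1] -/
@[simp]
theorem tatePairingAdicLinear_apply (x : H1 (tateRep W p) (κ.layerSubgroup n)) :
    tatePairingAdicLinear W κ v n hcompat hlin x = tatePairingAdic W κ v n hcompat x :=
  rfl

/-- **Residue formula** (linear glue): `tatePairingAdicLinear … x Q mod p^k = tatePairingPk W κ v n k x Q`. [cite: PerrinRiou1994Invent, §3.6.1] -/
theorem toZModPow_tatePairingAdicLinear (k : ℕ) (x : H1 (tateRep W p) (κ.layerSubgroup n))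
    (Q : localLayerPointsOfEmb κ (closureEmb (K := ℚ) (v.adicCompletion ℚ)) W n) :
    PadicInt.toZModPow k (tatePairingAdicLinear W κ v n hcompat hlin x Q) = tatePairingPk W κ v n k x Q :=
  toZModPow_tatePairingAdic W κ v n hcompat k x Q

end Weil

/-! ## §2 `T_ρ`: the glue of `rhoLayerPairingPk` (memo (R1): values in `ℤ_p`) -/

section Rho

variable {p : ℕ} [Fact p.Prime] (S : Set (PadicAlgCl p)) {d : ℕ} (ρ : FramedGaloisRep ℚ (padicCoeffIntegers S) d)
  (W : WeierstrassCurve ℚ) [W.IsElliptic] {r : ℕ}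
  (ePk : ∀ k : ℕ, ↥(AddSubgroup.torsionBy (Cofree ρ (padicCoeffField S)) ((p ^ k : ℕ) : ℤ)) →
    ↥(AddSubgroup.torsionBy (Cofree ρ (padicCoeffField S)) ((p ^ k : ℕ) : ℤ)) → AlgebraicClosure ℚ)
  (hμPk : ∀ k a b, ePk k a b ^ (p ^ k) = 1)
  (hadd₁Pk : ∀ k a₁ a₂ b, ePk k (a₁ + a₂) b = ePk k a₁ b * ePk k a₂ b)
  (hadd₂Pk : ∀ k a b₁ b₂, ePk k a (b₁ + b₂) = ePk k a b₁ * ePk k a b₂)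
  (hgalPk : ∀ k (σ : absoluteGaloisGroup ℚ) (a b : ↥(AddSubgroup.torsionBy (Cofree ρ (padicCoeffField S)) ((p ^ k : ℕ) : ℤ))),
    σ • ePk k a b = ePk k (cofreeTorsionGaloisModule S ρ _ σ a) (cofreeTorsionGaloisModule S ρ _ σ b))
  (Θ : Cofree ρ (padicCoeffField S) ≃+ (Fin r → W.geomPrimaryTorsion p)) (κ : ZpExtension ℚ p)
  (v : HeightOneSpectrum (𝓞 ℚ))
  (hΘ : ∀ (δ : absoluteGaloisGroup (v.adicCompletion ℚ)) (m : Cofree ρ (padicCoeffField S)) (i : Fin r),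
    Θ (resGalOfEmb (closureEmb (K := ℚ) (v.adicCompletion ℚ)) δ • m) i =
      resGalOfEmb (closureEmb (K := ℚ) (v.adicCompletion ℚ)) δ • Θ m i)
  (n : ℕ)
  (hcompat : ∀ (k : ℕ) (x : H1 (FramedGaloisRep.toGaloisRep ρ) (κ.layerSubgroup n))
    (Q : Fin r → localLayerPointsOfEmb κ (closureEmb (K := ℚ) (v.adicCompletion ℚ)) W n),
    (ZMod.cast (rhoLayerPairingPk S ρ W ePk hμPk hadd₁Pk hadd₂Pk hgalPk Θ κ v hΘ n (k + 1) x Q) : ZMod (p ^ k)) =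
      rhoLayerPairingPk S ρ W ePk hμPk hadd₁Pk hadd₂Pk hgalPk Θ κ v hΘ n k x Q)

/-- **THE `ℤ_p`-valued `ρ`-coefficient local Tate pairing of the `n`-th layer** (memo (R1), D4 (iii)),
`H¹(Γ_n, T_ρ) →+ (E(ℚ_{n,v})^r →+ ℤ_p)`: the glue (`padicIntLift₂`) of the finite-coefficient pairings `rhoLayerPairingPk … n k`
(values in `ℤ/p^k`), GIVEN their compatibility `hcompat` along `ℤ/p^{k+1} → ℤ/p^k`. Its residues are the `rhoLayerPairingPk`
(`toZModPow_rhoLayerPairingAdic`) and it is the only such homomorphism (`eq_rhoLayerPairingAdic_of_toZModPow`): the object that a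
statement «for every `pair` with these residues» speaks about. [cite: PerrinRiou1994Invent, §3.6.1] [cite: Kato2004Asterisque, §13.8
(pp. 228–229) and §14.9 (p. 239)] -/
def rhoLayerPairingAdic :
    H1 (FramedGaloisRep.toGaloisRep ρ) (κ.layerSubgroup n) →+
      ((Fin r → localLayerPointsOfEmb κ (closureEmb (K := ℚ) (v.adicCompletion ℚ)) W n) →+ ℤ_[p]) :=
  padicIntLift₂ p (fun k ↦ rhoLayerPairingPk S ρ W ePk hμPk hadd₁Pk hadd₂Pk hgalPk Θ κ v hΘ n k) hcompat

/-- **Residue formula**: `rhoLayerPairingAdic … x Q mod p^k = rhoLayerPairingPk … n k x Q`. [cite: PerrinRiou1994Invent, §3.6.1] -/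
@[simp]
theorem toZModPow_rhoLayerPairingAdic (k : ℕ) (x : H1 (FramedGaloisRep.toGaloisRep ρ) (κ.layerSubgroup n))
    (Q : Fin r → localLayerPointsOfEmb κ (closureEmb (K := ℚ) (v.adicCompletion ℚ)) W n) :
    PadicInt.toZModPow k (rhoLayerPairingAdic S ρ W ePk hμPk hadd₁Pk hadd₂Pk hgalPk Θ κ v hΘ n hcompat x Q) =
      rhoLayerPairingPk S ρ W ePk hμPk hadd₁Pk hadd₂Pk hgalPk Θ κ v hΘ n k x Q :=
  toZModPow_padicIntLift₂ p _ hcompat k x Q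

/-- **Uniqueness**: a bi-additive `F : H¹(Γ_n, T_ρ) →+ (E(ℚ_{n,v})^r →+ ℤ_p)` whose residues are the `rhoLayerPairingPk … n k` IS
`rhoLayerPairingAdic` (the single-`n` form of `eq_of_forall_toZModPow_eq_rhoLayerPairingPk`). [cite: PerrinRiou1994Invent, §3.6.1] -/
theorem eq_rhoLayerPairingAdic_of_toZModPow
    {F : H1 (FramedGaloisRep.toGaloisRep ρ) (κ.layerSubgroup n) →+
      ((Fin r → localLayerPointsOfEmb κ (closureEmb (K := ℚ) (v.adicCompletion ℚ)) W n) →+ ℤ_[p])}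
    (hF : ∀ (k : ℕ) (x : H1 (FramedGaloisRep.toGaloisRep ρ) (κ.layerSubgroup n))
      (Q : Fin r → localLayerPointsOfEmb κ (closureEmb (K := ℚ) (v.adicCompletion ℚ)) W n),
      PadicInt.toZModPow k (F x Q) = rhoLayerPairingPk S ρ W ePk hμPk hadd₁Pk hadd₂Pk hgalPk Θ κ v hΘ n k x Q) :
    F = rhoLayerPairingAdic S ρ W ePk hμPk hadd₁Pk hadd₂Pk hgalPk Θ κ v hΘ n hcompat :=
  eq_padicIntLift₂_of_toZModPow p _ hcompat hF

/-- `rhoLayerPairingAdic` does not depend on the compatibility witness, and two data with the same residues at `(x, Q)` give the same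
value there (residue-wise transfer, `padicIntLift₂_apply_eq_of_forall`). [cite: PerrinRiou1994Invent, §3.6.1] -/
theorem rhoLayerPairingAdic_apply_eq_of_forall
    {hcompat' : ∀ (k : ℕ) (x : H1 (FramedGaloisRep.toGaloisRep ρ) (κ.layerSubgroup n))
      (Q : Fin r → localLayerPointsOfEmb κ (closureEmb (K := ℚ) (v.adicCompletion ℚ)) W n),
      (ZMod.cast (rhoLayerPairingPk S ρ W ePk hμPk hadd₁Pk hadd₂Pk hgalPk Θ κ v hΘ n (k + 1) x Q) : ZMod (p ^ k)) =
        rhoLayerPairingPk S ρ W ePk hμPk hadd₁Pk hadd₂Pk hgalPk Θ κ v hΘ n k x Q}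
    {x x' : H1 (FramedGaloisRep.toGaloisRep ρ) (κ.layerSubgroup n)}
    {Q Q' : Fin r → localLayerPointsOfEmb κ (closureEmb (K := ℚ) (v.adicCompletion ℚ)) W n}
    (h : ∀ k : ℕ, rhoLayerPairingPk S ρ W ePk hμPk hadd₁Pk hadd₂Pk hgalPk Θ κ v hΘ n k x Q =
      rhoLayerPairingPk S ρ W ePk hμPk hadd₁Pk hadd₂Pk hgalPk Θ κ v hΘ n k x' Q') :
    rhoLayerPairingAdic S ρ W ePk hμPk hadd₁Pk hadd₂Pk hgalPk Θ κ v hΘ n hcompat x Q =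
      rhoLayerPairingAdic S ρ W ePk hμPk hadd₁Pk hadd₂Pk hgalPk Θ κ v hΘ n hcompat' x' Q' :=
  padicIntLift₂_apply_eq_of_forall p _ hcompat h

end Rho

end CyclotomicLayer

end Literature.NumberTheory.EllipticCurves

end
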